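import Literature.NumberTheory.EllipticCurves.Kobayashi2003.EtaColemanInterpolationCoherent
import Literature.NumberTheory.EllipticCurves.Kato2004.FrameOffsetDescent
import Literature.NumberTheory.EllipticCurves.IwasawaFunctionConstantDescent
import Literature.NumberTheory.EllipticCurves.Kato2004.AdmissibleZetaClassRealisabilityCM
import Literature.NumberTheory.EllipticCurves.Kato2004.AdmissibleZetaClassPositionProofs
import Literature.NumberTheory.EllipticCurves.Kato2004.AdmissibleZetaClassNonvanishingProofs
import Summits.BirchSwinnertonDyer.BirchSwinnertonDyer.Theorems.CyclotomicUntwistRohrlichAtLevel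
import Summits.BirchSwinnertonDyer.Rank1Residual.Additive.KatoDescentAdmissibleIstarZero
import Summits.BirchSwinnertonDyer.Rank1Residual.Additive.InertBadSignedBranchesCccOneLawOnTypeIstarZeroFrameUnit
import Mathlib.Algebra.Module.Torsion.Field
import HarnessLib

/-!
# Stub 2c-T1 (`stub_zetaLinesProportionalIstarZero`) of the line `kato_perrin_riou_istar` (item 19223) BY SIGNATURE,
# IN ONE COHERENT FRAME: from [A′] `Kobayashi2003.exists_colPlusInterpolationCoherent`, [C-align]
# `Kato2004.exists_traceCoherentRootSystem_of_definedExpStarBody`, (F-CM) and ONE named hypothesis `hC″` (the per-level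
# twist comparison in the `ι`-STANDARD frame) — THEOREMS ONLY (no `def`, no named fact, no instance, no notation, no `sorry`)

Cell `bsd-cm`, seat `bsd-cm-k-ty1` g40 (literature-prover identity): (T3) = file 3 of 3 of the re-typing docket of
director-bsd (993)(a)(iii)/(v) after critic NOTE #66 (K8-FRAME-DEFECT: [A] p834027 took its Gauss sum at Lean's per-level
distinguished root, not at a norm-coherent root system); pen D1211–D1217 (D1216: criteria (Q1)–(Q7)), critic
NOTE #68–#74, host E-g43-9 / eis S l.8299–8302. Supersedes F1 p835994 (`…OfColPlusInterpolation.lean`, which stays unconsumed).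
Lane `Rank1Residual/Additive/` (precedent p832718/p835994). Count-neutral until the pen's istar v18 cites the theorem BY NAME.

## What is proved (kernel, standard axioms)

`stub2cT1_of_colPlusInterpolationCoherent hA′ hCal hFCM hC″ : <TYPE of istar v17 ≡ v15's stub_zetaLinesProportionalIstarZero
VERBATIM>` (v15 sha16 1c7e623d6cf61178, l.380–397 = F1's conclusion l.243–259, token-identical):
- `hA′ : Kobayashi2003.exists_colPlusInterpolationCoherent` — [A′] p837519 (Kobayashi 2003 §8.4–8.7 in ONE coherent frame);
- `hCal : Kato2004.exists_traceCoherentRootSystem_of_definedExpStarBody` — [C-align] p837332 (`exp* ∘ cor = Tr ∘ exp*`);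
- `hFCM : Kato2004.exists_isAdmissibleZetaClass_of_hasCM_of_irreducible` — conjunct `.2.2.1` of `stub_printFactsKato`;
- `hC″` — ONE NAMED HYPOTHESIS, the per-level residue in the `ι`-STANDARD FRAME (pen D1216): F1's `hC` text
  (`g39/hC-text-l187-242.lean.txt` 13376185b7965aa3) with exactly three hunks — (H1) the (COH)-on-`zeta` block deleted;
  (H2) `∀ (ρ : ∀ n, CyclotomicField (cycLevel p (n+1) ∅) ℚ), (∀ n, ι (cycLevel p (n+1) ∅) (ρ n) = Complex.exp (2 * Real.pi *
  Complex.I / (p ^ (n+1) : ℂ))) →` inserted before `∀ (ιp : …),` and `Kobayashi2003.IsCoherentPadicEmbeddings p ρ ιp →` after it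
  (the roots are pinned by the datum's OWN `ι`, the binder entering `DefinedExpStarBody`/`ZetaBody`); (H3) `padicGaussSum … ψ′` ↦
  `padicGaussSumAt … (ρ n) ψ′`.  It says: at every EVEN `n`, every `ψ` mod `p^{n+1}` of order `2pⁿ`,
  `τ_ρ(ψ′)·Σ_b θ(b)·ιp(σ_b exp*_{n+1,∅}(res ∘ cor z_{p^{n+1}})) = C′·(w·M̃)(ψ(γ̃)−1)·Σ_a ψ(a)[a/p^{n+1}]^{±}_{f_V}` with ONE `C′`, ONE
  unit `w` (per-level bookkeeping: Kato Thm. 12.5 (1)/6.6/9.7, `L(f_W, χ̄, 1) = L(f_V, ηχ̄, 1)`, Birch on both sides, the period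
  relation of the twist; labelled RESEARCH by the cell; registered as v18's `stub_twistScalarIstarZeroStd`).  No per-level
  distinguished root, no trace predicate and no level map occur in `hC″` (pen D1216 (Q1)): all cross-level content is KERNEL
  GLUE — W2 `Kato2004.FrameOffsetDescent` and the frame unit `CccOneFrameUnit.exists_frameUnit`.

## Proof (F1″)

(i) `P₁` from `hA′`; admissible `z₁ ≠ 0` from `hFCM` + Rohrlich; the admissible body: exp*-datum `(f_W, d, ι, q, Λ)`, Kato
family `(z, x)` with `ZetaBody`, lift `y`, `M̃ ≠ 0`, position `(p^{A₀}M̃)•z₁ = (u p^{B₀})•y`.  (ii) FRAMES: `μ` TRACE-coherent with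
`Λ` (`hCal`); `ρ` `ι`-standard, offsets `μ_n = ρ_n^{o_n}`, `ιC` coherent on `ρ`, `ιA_n := ιC_n ∘ σ_{o_n⁻¹}` coherent on `μ`
(all PROVED in W2 §1–§2 — (Q7)).  (iii) [A′] at `(Λ, μ, ιA)` gives `λ ≠ 0`, `u_A ∈ Λˣ` and the law for `u_A·Col⁺`; re-framed by
W2 §3: `τ^{ιA}_μ = τ^{ιC}_ρ`, `pcs^{ιA}_θ = θ(o_n)·pcs^{ιC}_θ`; `hC″` at `(ρ, ιC)`; Kobayashi's law `isPlus_colPlus_z`; so at level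
`n`: value(u_A·Col⁺y) = (λC′/A_κ)·θ_ψ(o_n)·value(w·M̃·Col⁺P₁.z).  (iv) DESCENT (W2 ★): the offsets are tame-coherent beyond `n₁`;
FRAME UNIT: `U ∈ Λˣ` with `U(ψ(γ̃)−1) = θ_ψ(o_n)` for `n ≥ n₁`; ANNIHILATOR `Φ = (1+T)^{p^{n₁}} − 1` kills the levels `≤ n₁` on both
sides; hence `g := Φ·u_A·Col⁺(y)` and `h := Φ·U·w·M̃·Col⁺(P₁.z)` have proportional values at EVERY even level and (W1)
`IwasawaAlgebra.exists_pow_smul_eq_of_values_proportional` (p835629) gives `p^a g = v p^b h`; cancel `Φ ≠ 0` in the domain `Λ`,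
`Col⁺` injective, the position, `M̃ ≠ 0`, torsion-freeness ⇒ `p^{a+A₀} • z₁ = (unit · p^{B₀+b}) • P₁.z`; `units_smul`.

HONEST LABELS: a theorem about the stub's statement under four hypotheses (three Literature facts of record, one
RESEARCH-labelled per-level comparison `hC″`); 2c-T1 is NOT closed by this file; 19223/19945/19804 OPEN; no summit statement
is proved; `X12.CMInertBad` NOT proved; BSD is proved for no curve.
References: [Kobayashi2003] §8.4 (p. 16), Prop. 8.25–8.26, (8.29), Thm. 6.3; [Kato2004Asterisque] §4.2, Thm. 12.5 (1) (p. 221),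
Prop. 8.12, Thm. 9.7, Thm. 6.6, Lemma 13.10, Ex. 13.3; [Washington1997] §7.2, §13.1–13.2, Thm. 7.3; [RohrlichInventiones1984].
-/


noncomputable section

open scoped Classical NumberField TensorProduct

open WeierstrassCurve Literature.NumberTheory.EllipticCurves Literature.NumberTheory.GaloisRepresentations
open Literature.NumberTheory.EllipticCurves.ModularForms
open Literature.NumberTheory.EllipticCurves.Rank1Residual
open Literature.NumberTheory.EllipticCurves.Rank1Residual.Typed
open Literature.NumberTheory.EllipticCurves.IwasawaAlgebra
open Summit.BirchSwinnertonDyer.Rank1Residual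
open Summit.BirchSwinnertonDyer.Rank1Residual.Additive
open Summit.BirchSwinnertonDyer.Rank1Residual.X12.O10
open Literature.NumberTheory.EllipticCurves.Kato2004
open Literature.NumberTheory.EllipticCurves.Kato2004.EulerSystemValues
open Literature.NumberTheory.EllipticCurves.Kobayashi2003
open Summit.BirchSwinnertonDyer.BirchSwinnertonDyer.Theorems

namespace Summit.BirchSwinnertonDyer.Rank1Residual.Additive.CccOneZetaLinesCoherent

set_option backward.isDefEq.respectTransparency false

set_option maxHeartbeats 1600000 in
/-- **Stub 2c-T1 of `kato_perrin_riou_istar` BY SIGNATURE, in one coherent frame** from [A′]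
`Kobayashi2003.exists_colPlusInterpolationCoherent`, [C-align] `Kato2004.exists_traceCoherentRootSystem_of_definedExpStarBody`,
(F-CM) `Kato2004.exists_isAdmissibleZetaClass_of_hasCM_of_irreducible` and ONE named hypothesis `hC″` (the per-level twist
comparison in the `ι`-standard frame, module docstring): for every row member `W` of signed type `(p, I₀*)`, `p ≥ 5`,
`r_an = 1`, every frame and every `I`, an admissible `z₁` and Kobayashi's datum `P₁` lie on ONE `Λ`-line of `𝐇¹` up to
`p`-powers.  The cross-level frame bookkeeping is kernel glue (`Kato2004.FrameOffsetDescent`, `CccOneFrameUnit`).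
Count-neutral helper; nothing about BSD is asserted; 19223 stays OPEN.
[cite: Kobayashi2003, §8.4 (p. 16), Prop. 8.25, (8.29), Prop. 8.26 (pp. 24–25), Thm. 6.3 (p. 11)]
[cite: Kato2004Asterisque, §4.2 (p. 143), Thm. 12.5 (1) (p. 221), Prop. 8.12 (p. 186), Thm. 9.7 (p. 189), Thm. 6.6 (p. 163), Lemma 13.10 (p. 230)]
[cite: Washington1997, §7.2, §13.1 and Thm. 7.3] -/
theorem stub2cT1_of_colPlusInterpolationCoherent
    (hA' : Kobayashi2003.exists_colPlusInterpolationCoherent)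
    (hCal : Kato2004.exists_traceCoherentRootSystem_of_definedExpStarBody)
    (hFCM : Kato2004.exists_isAdmissibleZetaClass_of_hasCM_of_irreducible)
    (hC'' : ∀ (p : ℕ) [Fact p.Prime] (hp : p ≠ 2), 5 ≤ p →
      ∀ (K₀ : Type) [Field K₀] [NumberField K₀] [IsCyclotomicExtension {p} ℚ K₀]
        (η : Field.absoluteGaloisGroup ℚ →* ℤˣ), (∀ σ ∈ galRange (K := ℚ) K₀, η σ = 1) → η ≠ 1 →
      ∀ (V : WeierstrassCurve ℚ) [V.IsElliptic] [V.IsGloballyMinimal] {N : ℕ} [NeZero N]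
        {f : CuspForm (CongruenceSubgroup.Gamma0 N) 2},
        V.HasGoodReductionAtPrime p → V.frobeniusTrace p = 0 → ModularForms.IsNewformOf V f →
      ∀ (W : WeierstrassCurve ℚ) [W.IsElliptic] [ContinuousSMul ℤ_[p] (W.tateModule p)]
        [Module.Free ℤ_[p] (W.tateModule p)] [Module.Finite ℤ_[p] (W.tateModule p)]
        (C : VariableChange ℚ), C • W.quadraticTwist ((-1) ^ (p / 2) * p) = V →
      ∀ (κ : ZpExtension ℚ p) (hκ : κ.IsCyclotomic)
        {NW : ℕ} [NeZero NW] (fW : CuspForm (CongruenceSubgroup.Gamma0 NW) 2), ModularForms.IsNewformOf W fW →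
      ∀ (ι : (m : ℕ) → (CyclotomicField m ℚ →+* ℂ)) (q : ℚ)
        (Λ : ∀ (k : ℕ) (r : Finset (IsDedekindDomain.HeightOneSpectrum (𝓞 ℚ))),
          H1 (tateRep W p) (cycSubgroup p k r) →ₗ[ℤ_[p]]
            ℚ_[p] ⊗[ℚ] CyclotomicField (cycLevel p k r) ℚ)
        (d : _), Kato2004.DefinedExpStarBody W p fW d ι ((q : ℚ) : ℝ) Λ →
      ∀ (c d₁ a : ℤ) (A : ℕ) (d' : ℤ), 0 < A → Int.gcd c (6 * p * A) = 1 → Int.gcd d₁ (6 * p * NW) = 1 →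
        (d₁ : ℤ) * d' ≡ 1 [ZMOD (A : ℤ)] → ratCuspFactor fW true c d₁ a A d' ≠ 0 →
      ∀ (z : ∀ (k : ℕ) (r : (cyclotomicLevelsRat p (badPlaces c d₁ A NW)).Ideals),
            H1 (tateRep W p) ((cyclotomicLevelsRat p (badPlaces c d₁ A NW)).level k r.1))
        (x : ∀ (k : ℕ) (r : (cyclotomicLevelsRat p (badPlaces c d₁ A NW)).Ideals),
            CyclotomicField (cycLevel p k r.1) ℚ),
        Kato2004.ZetaBody W p fW ι ((q : ℚ) : ℝ) Λ c d₁ a A z x →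
      ∀ (qm : ℚ) (n₁ n₂ n₃ n₄ : ℤ) (σc σd : Field.absoluteGaloisGroup ℚ) (σℓ : ℕ → Field.absoluteGaloisGroup ℚ),
        0 < qm → AddSubgroup.closure (Set.range (ratMinusSymbol fW)) = AddSubgroup.zmultiples qm →
        ratMinusSymbol fW ((a : ℚ) / A) = n₁ * qm → ratMinusSymbol fW ((a * c : ℚ) / A) = n₂ * qm →
        ratMinusSymbol fW ((a * d' : ℚ) / A) = n₃ * qm → ratMinusSymbol fW ((a * c * d' : ℚ) / A) = n₄ * qm →
        ((GaloisRep.cyclotomicCharacter ℚ p σc : ℤ_[p]ˣ) : ℤ_[p]) = c →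
        ((GaloisRep.cyclotomicCharacter ℚ p σd : ℤ_[p]ˣ) : ℤ_[p]) = d₁ →
        (∀ ℓ ∈ A.primeFactors.erase p, ((GaloisRep.cyclotomicCharacter ℚ p (σℓ ℓ) : ℤ_[p]ˣ) : ℤ_[p]) = ℓ) →
      ∀ (ρ : ∀ n : ℕ, CyclotomicField (cycLevel p (n + 1) ∅) ℚ),
        (∀ n : ℕ, ι (cycLevel p (n + 1) ∅) (ρ n) = Complex.exp (2 * Real.pi * Complex.I / (p ^ (n + 1) : ℂ))) →
      ∀ (ιp : (m : ℕ) → (CyclotomicField m ℚ →+* ℂ_[p])),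
        Kobayashi2003.IsCoherentPadicEmbeddings p ρ ιp →
      ∃ (C' : ℂ_[p]) (w : (IwasawaAlgebra p)ˣ), ∀ n : ℕ, Even n →
        ∀ ψ : DirichletCharacter ℂ_[p] (p ^ (n + 1)), orderOf ψ = 2 * p ^ n →
        ∀ t : ℂ_[p],
          HasSum (fun k : ℕ ↦ ((algebraMap ℚ_[p] ℂ_[p]).comp (algebraMap ℤ_[p] ℚ_[p]))
              (PowerSeries.coeff k ((w : IwasawaAlgebra p) *
                katoMultiplier p c d₁ n₁ n₂ n₃ n₄
                  ((IwasawaCharacter.Psi p ℤ_[p] κ σc : (PowerSeries ℤ_[p])ˣ) : IwasawaAlgebra p)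
                  ((IwasawaCharacter.Psi p ℤ_[p] κ σd : (PowerSeries ℤ_[p])ˣ) : IwasawaAlgebra p)
                  (A.primeFactors.erase p) (fun ℓ => W.LFunction ℓ) (fun ℓ => if ℓ ∣ NW then 0 else 1)
                  (fun ℓ => ((IwasawaCharacter.Psi p ℤ_[p] κ (σℓ ℓ) : (PowerSeries ℤ_[p])ˣ) : IwasawaAlgebra p)))) *
              (ψ (cyclotomicGenerator p : ZMod (p ^ (n + 1))) - 1) ^ k) t →
          Kobayashi2003.padicGaussSumAt p (cycLevel p (n + 1) ∅) (ιp (cycLevel p (n + 1) ∅)) (ρ n)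
              (DirichletCharacter.changeLevel (dvd_mul_right _ _ : p ^ (n + 1) ∣ cycLevel p (n + 1) ∅) ψ) *
            Kobayashi2003.padicCharSum p (cycLevel p (n + 1) ∅) (ιp (cycLevel p (n + 1) ∅))
              ((DirichletCharacter.changeLevel (dvd_mul_right _ _ : p ^ (n + 1) ∣ cycLevel p (n + 1) ∅) ψ) ^
                (p ^ n - 1))
              (Λ (n + 1) ∅ (resLe (tateRep W p).toTopRep
                (hκ.cyclotomicLevelsRat_level_succ_le_layerSubgroup hp ∅ n) 1
                (levelToLayer W p hκ hp (badPlaces c d₁ A NW) n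
                  (z (n + 1) (cyclotomicLevelsRat p (badPlaces c d₁ A NW)).idealOne)))) =
          C' * t * (if Even (p / 2) then ratTwistedSymbolSum f ψ else ratMinusTwistedSymbolSum f ψ)) :
    ∀ (p : ℕ) [Fact p.Prime], 5 ≤ p → ∀ (W : WeierstrassCurve ℚ) [W.IsElliptic] [W.IsGloballyMinimal],
      HasSignedLocalType W p (.Istar 0) → W.analyticRank = 1 →
      letI : ContinuousSMul ℤ_[p] (W.tateModule p) := TateModule.continuousSMul_padicInt
      ∀ (K₀ : Type) [Field K₀] [NumberField K₀] [IsCyclotomicExtension {p} ℚ K₀] [(galRange (K := ℚ) K₀).Normal]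
        (η : Field.absoluteGaloisGroup ℚ →* ℤˣ), (∀ σ ∈ galRange (K := ℚ) K₀, η σ = 1) → η ≠ 1 →
      ∀ (V : WeierstrassCurve ℚ) [V.IsElliptic] [V.IsGloballyMinimal] {N : ℕ} [NeZero N]
        {f : CuspForm (CongruenceSubgroup.Gamma0 N) 2},
        V.HasCM → V.HasGoodReductionAtPrime p → V.frobeniusTrace p = 0 → ModularForms.IsNewformOf V f →
      ∀ (ϖ : ℚ), (if Even (p / 2) then (ϖ : ℝ) * V.realPeriodRat = ModularForms.plusPeriod f
          else (ϖ : ℝ) * V.imaginaryPeriodRat = ModularForms.minusPeriod f) →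
      ∀ (κ : ZpExtension ℚ p) (hκ : κ.IsCyclotomic) (γ : Field.absoluteGaloisGroup ℚ) (_ : κ.IsTopGenerator γ),
        γ ∈ galRange (K := ℚ) K₀ → IsCyclotomicVariable p γ →
      ∀ (C : VariableChange ℚ), C • W.quadraticTwist ((-1) ^ (p / 2) * p) = V →
      ∀ (I : IwasawaH1Data W p κ γ),
        ∃ (FB₁ : W.FineSelmerDualData κ γ) (P₁ : Kobayashi2003.EtaColemanPoitouTateData p K₀ η V f ϖ κ γ W I FB₁)
          (z₁ : I.H) (a b : ℕ), Kato2004.IsAdmissibleZetaClass W p κ hκ I z₁ ∧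
            ((p : IwasawaAlgebra p) ^ a) • P₁.z = ((p : IwasawaAlgebra p) ^ b) • z₁ := by
  intro p _ hp5 W _ _ hT _ K₀ _ _ _ _ η hη hη1 V _ _ N _ f _ hgood hap hf ϖ hϖ κ hκ γ hγ hγK hvar C hCW I
  letI : ContinuousSMul ℤ_[p] (W.tateModule p) := TateModule.continuousSMul_padicInt
  have hP : p.Prime := Fact.out
  have hp2 : p ≠ 2 := by omega
  have hirr := StrictCount.hasIrreducibleModPGaloisRep_of_hasSignedLocalType_IstarZero W p hp5 hT
  obtain ⟨z₁, hz₁⟩ := hFCM W p κ γ hκ hγ hp2 hT.1 hT.2.1.1 hirr I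
  set FB₁ : W.FineSelmerDualData κ γ := W.fineSelmerDualData κ hγ with hFB₁
  obtain ⟨P₁, hP₁⟩ := hA' p K₀ η hη hη1 V hp2 hgood hap hf ϖ hϖ κ γ hκ hγ hγK hvar W C hCW I FB₁
  letI : Module.Free ℤ_[p] (W.tateModule p) := W.module_free_tateModule_holds p
  letI : Module.Finite ℤ_[p] (W.tateModule p) := W.module_finite_tateModule_holds p
  have hz₁0 : z₁ ≠ 0 :=
    hz₁.ne_zero_of_rohrlich hγ fun hfW => PSRohrlichAtLevel.rohrlich_primePow_of_isNewformOf hfW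
  obtain ⟨hp2', NW, hNW, fW, hfW, ι, q, Λ, hq, ⟨d, hbody, -⟩, c, d₁, a, A, d', hA0, hc, hd, hdd', hR, z, x,
    hzeta, y, hy, qm, perRatio, e, u, n₁, n₂, n₃, n₄, σc, σd, σℓ, hqm, hspan, h₁, h₂, h₃, h₄, hσc, hσd, hσℓ,
    -, -, -, hpos⟩ := (isAdmissibleZetaClass_iff W p κ hκ I z₁).mp hz₁
  set M : IwasawaAlgebra p := katoMultiplier p c d₁ n₁ n₂ n₃ n₄
      ((IwasawaCharacter.Psi p ℤ_[p] κ σc : (PowerSeries ℤ_[p])ˣ) : IwasawaAlgebra p)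
      ((IwasawaCharacter.Psi p ℤ_[p] κ σd : (PowerSeries ℤ_[p])ˣ) : IwasawaAlgebra p)
      (A.primeFactors.erase p) (fun ℓ => W.LFunction ℓ) (fun ℓ => if ℓ ∣ NW then 0 else 1)
      (fun ℓ => ((IwasawaCharacter.Psi p ℤ_[p] κ (σℓ ℓ) : (PowerSeries ℤ_[p])ˣ) : IwasawaAlgebra p)) with hM
  have hM0 : M ≠ 0 := katoMultiplier_ne_zero (p := p) W hfW κ c d₁ a A d' hqm.ne' h₁ h₂ h₃ h₄ hR σc σd σℓ
  set Pp : IwasawaAlgebra p := (p : IwasawaAlgebra p) with hPp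
  haveI hNZ : NoZeroSMulDivisors (IwasawaAlgebra p) I.H := I.noZeroSMulDivisors hγ
  have hPp0 : Pp ≠ 0 := by
    have h := pow_mul_ne_zero_of_ne_zero p (one_ne_zero : (1 : IwasawaAlgebra p) ≠ 0) 1
    rwa [pow_one, mul_one] at h
  have hy0 : y ≠ 0 := fun hy0 => hz₁0
    ((IwasawaH1Data.eq_zero_iff_of_smul_eq_smul hγ I (pow_mul_ne_zero_of_ne_zero p hM0 _)
      (mul_ne_zero (Units.ne_zero u) (pow_ne_zero _ hPp0)) hpos).mpr hy0)
  have hg0 : P₁.colPlus y ≠ 0 := fun h0 => hy0 (P₁.colPlus_injective (by rw [h0, map_zero]))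
  -- (ii) FRAMES: `μ` TRACE-coherent, `ρ` `ι`-standard, offsets `o`, readings `ιC` (coherent on `ρ`), `ιA` (coherent on `μ`)
  obtain ⟨μ, hμ⟩ := hCal W p fW d ι ((q : ℚ) : ℝ) Λ hbody
  obtain ⟨ρ, hρprim, hρ⟩ := FrameOffsetDescent.exists_standardRootSystem (p := p) ι
  obtain ⟨o, ho⟩ := FrameOffsetDescent.exists_offsets hμ.1 hρprim
  obtain ⟨ιC, hCOH⟩ := FrameOffsetDescent.exists_isCoherentPadicEmbeddings ρ hρprim
  obtain ⟨ιA, hιA⟩ := FrameOffsetDescent.exists_twistedFamily ιC (fun n => (o n)⁻¹)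
  have hCOHA : IsCoherentPadicEmbeddings p μ ιA :=
    FrameOffsetDescent.isCoherentPadicEmbeddings_of_twisted hρprim ho hιA hCOH
  -- (iii) [A′] at `(Λ, μ, ιA)`; `hC″` at `(ρ, ιC)`
  obtain ⟨lam, uA, -, hlaw⟩ := hP₁ fW d ι ((q : ℚ) : ℝ) Λ hbody μ hμ ιA hCOHA
  obtain ⟨C', w, hCval⟩ := hC'' p hp2 hp5 K₀ η hη hη1 V hgood hap hf W C hCW κ hκ fW hfW ι q Λ d hbody
    c d₁ a A d' hA0 hc hd hdd' hR z x hzeta qm n₁ n₂ n₃ n₄ σc σd σℓ hqm hspan h₁ h₂ h₃ h₄ hσc hσd hσℓ ρ hρ ιC hCOH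
  -- (iv) DESCENT (W2) and the FRAME UNIT
  have hq0 : (((q : ℚ) : ℝ)) ≠ 0 := by exact_mod_cast hq
  obtain ⟨nT, hnT⟩ := FrameOffsetDescent.exists_forall_offset_pow_sub_one_eq_one hp2 hfW hq0 hA0 hc hd hdd' hR
    hzeta (PSRohrlichAtLevel.rohrlich_primePow_of_isNewformOf hfW) hμ hρ ho
  obtain ⟨U, hU⟩ := CccOneFrameUnit.exists_frameUnit hκ hγ hvar hp2 o nT
    (fun n hn => FrameOffsetDescent.unitsMap_pow_eq_pow_of_tame (hnT n hn))
  -- Kobayashi's law for `Col⁺(P₁.z)` and the constant `A_κ`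
  obtain ⟨uK, huK⟩ := P₁.isPlus_colPlus_z
  have hϖ0 : ϖ ≠ 0 := by
    rintro rfl
    have hQ := hf.coeffField_eq_bot_of_isNewformOf
    by_cases hδ : Even (p / 2)
    · rw [if_pos hδ] at hϖ
      have hpos' := IsNewform0.plusPeriod_pos_holds hf.1 hQ
      rw [← hϖ] at hpos'
      simp at hpos'
    · rw [if_neg hδ] at hϖ
      have hpos' := IsNewform0.minusPeriod_pos_holds hf.1 hQ
      rw [← hϖ] at hpos'
      simp at hpos'
  set Aκ : ℂ_[p] := algebraMap ℚ_[p] ℂ_[p] (((uK : ℤ_[p]) : ℚ_[p]) * (ϖ : ℚ_[p])) with hAκ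
  have hAκ0 : Aκ ≠ 0 := by
    rw [hAκ]
    refine (map_ne_zero _).mpr (mul_ne_zero ?_ (by exact_mod_cast hϖ0))
    exact fun h0 => Units.ne_zero uK (PadicInt.coe_eq_zero.mp h0)
  -- the annihilator `Φ`, the elements `g := Φ·u_A·Col⁺(y)`, `hh := Φ·U·w·M̃·Col⁺(P₁.z)` and the constant
  have hΦ0 : ((1 + PowerSeries.X : PowerSeries ℤ_[p]) ^ p ^ nT - 1) ≠ 0 :=
    CccOneFrameUnit.onePlusXPow_sub_one_ne_zero nT
  set G₀ : IwasawaAlgebra p := (uA : IwasawaAlgebra p) * P₁.colPlus y with hG₀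
  set H₀ : IwasawaAlgebra p := ((U : IwasawaAlgebra p) * ((w : IwasawaAlgebra p) * M)) * P₁.colPlus P₁.z with hH₀
  have hgne : ((1 + PowerSeries.X : PowerSeries ℤ_[p]) ^ p ^ nT - 1) * G₀ ≠ 0 :=
    mul_ne_zero hΦ0 (mul_ne_zero (Units.ne_zero uA) hg0)
  set Cst : ℂ_[p] := lam * C' / Aκ with hCst
  set ιZ : ℤ_[p] →+* ℂ_[p] := (algebraMap ℚ_[p] ℂ_[p]).comp (algebraMap ℤ_[p] ℚ_[p]) with hιZ
  have H : ∀ n : ℕ, Even n → 0 < n → ∀ ψ : DirichletCharacter ℂ_[p] (p ^ (n + 1)), orderOf ψ = 2 * p ^ n →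
      ∀ a b : ℂ_[p],
        HasSum (fun k ↦ ιZ (PowerSeries.coeff k (((1 + PowerSeries.X : PowerSeries ℤ_[p]) ^ p ^ nT - 1) * G₀)) *
          (ψ (cyclotomicGenerator p : ZMod (p ^ (n + 1))) - 1) ^ k) a →
        HasSum (fun k ↦ ιZ (PowerSeries.coeff k (((1 + PowerSeries.X : PowerSeries ℤ_[p]) ^ p ^ nT - 1) * H₀)) *
          (ψ (cyclotomicGenerator p : ZMod (p ^ (n + 1))) - 1) ^ k) b →
        a = Cst * b := by
    intro n hn _ ψ hψ a b ha hb
    have hz : ‖ψ (cyclotomicGenerator p : ZMod (p ^ (n + 1))) - 1‖ < 1 :=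
      CccOneTwistScalarMultiplierValue.norm_apply_cyclotomicGenerator_sub_one_lt hp2 n ψ
    rw [← ha.tsum_eq, ← hb.tsum_eq]
    rcases le_or_gt n nT with hle | hlt
    · -- levels `≤ nT`: both values vanish
      rw [CccOneFrameUnit.tsum_onePlusXPow_sub_one_mul_eq_zero hp2 hle ψ G₀,
        CccOneFrameUnit.tsum_onePlusXPow_sub_one_mul_eq_zero hp2 hle ψ H₀, mul_zero]
    · -- levels `> nT`: [A′] re-framed, `hC″`, Kobayashi's law, the frame unit
      have hAy := hlaw y n hn ψ hψ
      rw [hy n] at hAy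
      have hKz := huK n hn ψ hψ
      have hUv := hU n hlt.le ψ
      have hsumM : Summable fun k ↦ ιZ (PowerSeries.coeff k ((w : IwasawaAlgebra p) * M)) *
          (ψ (cyclotomicGenerator p : ZMod (p ^ (n + 1))) - 1) ^ k :=
        summable_map_coeff_mul_pow ιZ (norm_algebraMap_coeff_le_one _) hz
      set t : ℂ_[p] := ∑' k, ιZ (PowerSeries.coeff k ((w : IwasawaAlgebra p) * M)) *
          (ψ (cyclotomicGenerator p : ZMod (p ^ (n + 1))) - 1) ^ k with ht
      have hCv := hCval n hn ψ hψ t hsumM.hasSum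
      -- re-framing `ιA ↦ ιC`
      have hμn1 : (μ n) ^ (cycLevel p (n + 1) ∅) = 1 := by
        have h1 : (ρ n) ^ (cycLevel p (n + 1) ∅) = 1 := by
          have := (hρprim n).pow_eq_one
          simpa [cycLevel] using this
        rw [ho n, pow_right_comm, h1, one_pow]
      have hτ : padicGaussSumAt p (cycLevel p (n + 1) ∅) (ιA (cycLevel p (n + 1) ∅)) (μ n)
            (DirichletCharacter.changeLevel
              (show p ^ (n + 1) ∣ cycLevel p (n + 1) ∅ from dvd_mul_right _ _) ψ) =
          padicGaussSumAt p (cycLevel p (n + 1) ∅) (ιC (cycLevel p (n + 1) ∅)) (ρ n)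
            (DirichletCharacter.changeLevel
              (show p ^ (n + 1) ∣ cycLevel p (n + 1) ∅ from dvd_mul_right _ _) ψ) := by
        rw [padicGaussSumAt_def, padicGaussSumAt_def, FrameOffsetDescent.apply_eq_of_twisted hρprim ho hιA n]
      have hpcs := FrameOffsetDescent.padicCharSum_eq_of_comp_sigma (ιA (cycLevel p (n + 1) ∅))
        (ιC (cycLevel p (n + 1) ∅)) (o n)⁻¹ (hιA n)
        ((DirichletCharacter.changeLevel
          (show p ^ (n + 1) ∣ cycLevel p (n + 1) ∅ from dvd_mul_right _ _) ψ) ^ (p ^ n - 1))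
        (Λ (n + 1) ∅ (resLe (tateRep W p).toTopRep
          (hκ.cyclotomicLevelsRat_level_succ_le_layerSubgroup hp2 ∅ n) 1
          (levelToLayer W p hκ hp2 (badPlaces c d₁ A NW) n
            (z (n + 1) (cyclotomicLevelsRat p (badPlaces c d₁ A NW)).idealOne))))
      rw [inv_inv] at hpcs
      -- products of values
      have hΦG := tsum_map_coeff_mul_mul_pow ιZ
        (norm_algebraMap_coeff_le_one ((1 + PowerSeries.X : PowerSeries ℤ_[p]) ^ p ^ nT - 1))
        (norm_algebraMap_coeff_le_one G₀) hz
      have hΦH := tsum_map_coeff_mul_mul_pow ιZ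
        (norm_algebraMap_coeff_le_one ((1 + PowerSeries.X : PowerSeries ℤ_[p]) ^ p ^ nT - 1))
        (norm_algebraMap_coeff_le_one H₀) hz
      have hH₀v := tsum_map_coeff_mul_mul_pow ιZ
        (norm_algebraMap_coeff_le_one ((U : IwasawaAlgebra p) * ((w : IwasawaAlgebra p) * M)))
        (norm_algebraMap_coeff_le_one (P₁.colPlus P₁.z)) hz
      have hUwM := tsum_map_coeff_mul_mul_pow ιZ (norm_algebraMap_coeff_le_one (U : IwasawaAlgebra p))
        (norm_algebraMap_coeff_le_one ((w : IwasawaAlgebra p) * M)) hz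
      set Φv : ℂ_[p] := ∑' k, ιZ (PowerSeries.coeff k ((1 + PowerSeries.X : PowerSeries ℤ_[p]) ^ p ^ nT - 1)) *
          (ψ (cyclotomicGenerator p : ZMod (p ^ (n + 1))) - 1) ^ k with hΦv
      rw [hΦG, hΦH, hG₀, hAy.tsum_eq, hH₀, hH₀v, hUwM, hUv.tsum_eq, hKz.tsum_eq, ← ht, hτ, hpcs]
      set E : ℂ_[p] := (-1 : ℂ_[p]) ^ (n / 2 + 1)
      set ω : ℂ_[p] := (cyclotomicOmegaMinus p n).eval₂ (algebraMap ℤ ℂ_[p])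
        (ψ (cyclotomicGenerator p : ZMod (p ^ (n + 1))) - 1)
      set S : ℂ_[p] := (if Even (p / 2) then ratTwistedSymbolSum f ψ else ratMinusTwistedSymbolSum f ψ)
      have key : ∀ θo τ' P' : ℂ_[p], τ' * P' = C' * t * S →
          Φv * (lam * (E * τ' / ω) * (θo * P')) = lam * C' / Aκ * (Φv * (θo * t * (E * Aκ * S / ω))) := by
        intro θo τ' P' hτP
        calc Φv * (lam * (E * τ' / ω) * (θo * P')) = Φv * lam * E * θo * (τ' * P') * ω⁻¹ := by ring
          _ = Φv * lam * E * θo * (C' * t * S) * ω⁻¹ := by rw [hτP]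
          _ = lam * C' / Aκ * (Φv * (θo * t * (E * Aκ * S / ω))) := by
            rw [div_eq_mul_inv, div_eq_mul_inv, ← mul_one (Φv * lam * E * θo * (C' * t * S) * ω⁻¹),
              ← mul_inv_cancel₀ hAκ0]
            ring
      exact key _ _ _ hCv
  -- (W1): descent of the constant, `p^a · g = (v·p^b) · hh` in `Λ`
  obtain ⟨-, -, -, a₁, b₁, v, hab⟩ :=
    IwasawaAlgebra.exists_pow_smul_eq_of_values_proportional (p := p) hp2 hgne Cst H
  have hab' : Pp ^ a₁ * (((1 + PowerSeries.X : PowerSeries ℤ_[p]) ^ p ^ nT - 1) * G₀) =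
      (PowerSeries.C (v : ℤ_[p]) * Pp ^ b₁) * (((1 + PowerSeries.X : PowerSeries ℤ_[p]) ^ p ^ nT - 1) * H₀) := by
    have h := hab
    rw [PowerSeries.smul_eq_C_mul, PowerSeries.smul_eq_C_mul, map_pow, map_mul, map_pow, map_natCast] at h
    exact h
  -- cancel the annihilator `Φ ≠ 0` in the domain `Λ`
  have hab'' : Pp ^ a₁ * G₀ = (PowerSeries.C (v : ℤ_[p]) * Pp ^ b₁) * H₀ := by
    apply mul_left_cancel₀ hΦ0
    calc ((1 + PowerSeries.X : PowerSeries ℤ_[p]) ^ p ^ nT - 1) * (Pp ^ a₁ * G₀)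
        = Pp ^ a₁ * (((1 + PowerSeries.X : PowerSeries ℤ_[p]) ^ p ^ nT - 1) * G₀) := by ring
      _ = (PowerSeries.C (v : ℤ_[p]) * Pp ^ b₁) * (((1 + PowerSeries.X : PowerSeries ℤ_[p]) ^ p ^ nT - 1) * H₀) := hab'
      _ = ((1 + PowerSeries.X : PowerSeries ℤ_[p]) ^ p ^ nT - 1) * ((PowerSeries.C (v : ℤ_[p]) * Pp ^ b₁) * H₀) := by
          ring
  -- (eq1) `p^a · y = (u_A⁻¹ v p^b U w M̃) · P₁.z` in `𝐇¹` by injectivity of `Col⁺`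
  set vΛ : (IwasawaAlgebra p)ˣ := Units.map (PowerSeries.C : ℤ_[p] →+* IwasawaAlgebra p).toMonoidHom v with hvΛ
  have hvΛc : (vΛ : IwasawaAlgebra p) = PowerSeries.C (v : ℤ_[p]) := rfl
  set Uu : (IwasawaAlgebra p)ˣ := uA⁻¹ * vΛ * U * w with hUu
  have e1 : (Pp ^ a₁) • y = ((Uu : IwasawaAlgebra p) * Pp ^ b₁ * M) • P₁.z := by
    apply P₁.colPlus_injective
    rw [map_smul, map_smul, smul_eq_mul, smul_eq_mul, hUu, Units.val_mul, Units.val_mul, Units.val_mul, hvΛc]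
    calc Pp ^ a₁ * P₁.colPlus y
        = ((uA⁻¹ : (IwasawaAlgebra p)ˣ) : IwasawaAlgebra p) * ((uA : IwasawaAlgebra p) * (Pp ^ a₁ * P₁.colPlus y)) := by
          rw [← mul_assoc, Units.inv_mul, one_mul]
      _ = ((uA⁻¹ : (IwasawaAlgebra p)ˣ) : IwasawaAlgebra p) * (Pp ^ a₁ * G₀) := by rw [hG₀]; ring
      _ = ((uA⁻¹ : (IwasawaAlgebra p)ˣ) : IwasawaAlgebra p) * ((PowerSeries.C (v : ℤ_[p]) * Pp ^ b₁) * H₀) := by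
          rw [hab'']
      _ = ((uA⁻¹ : (IwasawaAlgebra p)ˣ) : IwasawaAlgebra p) * PowerSeries.C (v : ℤ_[p]) * (U : IwasawaAlgebra p) *
            (w : IwasawaAlgebra p) * Pp ^ b₁ * M * P₁.colPlus P₁.z := by rw [hH₀]; ring
  -- (eq3) multiply the position by `p^a` and cancel `M̃`
  set UU : (IwasawaAlgebra p)ˣ := u * Uu with hUU
  have e3 : M • ((Pp ^ (a₁ + (-e).toNat)) • z₁) = M • (((UU : IwasawaAlgebra p) * Pp ^ (e.toNat + b₁)) • P₁.z) := by
    calc M • ((Pp ^ (a₁ + (-e).toNat)) • z₁)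
        = (Pp ^ a₁) • ((Pp ^ (-e).toNat * M) • z₁) := by
          rw [smul_smul, smul_smul]
          exact congrArg (fun r : IwasawaAlgebra p => r • z₁) (by ring)
      _ = (Pp ^ a₁) • (((u : IwasawaAlgebra p) * Pp ^ e.toNat) • y) := by rw [hpos]
      _ = ((u : IwasawaAlgebra p) * Pp ^ e.toNat) • ((Pp ^ a₁) • y) := by
          rw [smul_smul, smul_smul]
          exact congrArg (fun r : IwasawaAlgebra p => r • y) (mul_comm _ _)
      _ = ((u : IwasawaAlgebra p) * Pp ^ e.toNat) • (((Uu : IwasawaAlgebra p) * Pp ^ b₁ * M) • P₁.z) := by rw [e1]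
      _ = M • (((UU : IwasawaAlgebra p) * Pp ^ (e.toNat + b₁)) • P₁.z) := by
          rw [smul_smul, smul_smul]
          exact congrArg (fun r : IwasawaAlgebra p => r • P₁.z) (by simp only [hUU, hUu, Units.val_mul]; ring)
  have e4 : (Pp ^ (a₁ + (-e).toNat)) • z₁ = ((UU : IwasawaAlgebra p) * Pp ^ (e.toNat + b₁)) • P₁.z :=
    smul_right_injective I.H hM0 e3
  refine ⟨FB₁, P₁, ((UU⁻¹ : (IwasawaAlgebra p)ˣ) : IwasawaAlgebra p) • z₁, e.toNat + b₁, a₁ + (-e).toNat,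
    hz₁.units_smul UU⁻¹, ?_⟩
  rw [smul_smul, mul_comm, ← smul_smul, e4, smul_smul, ← mul_assoc, Units.inv_mul, one_mul]

end Summit.BirchSwinnertonDyer.Rank1Residual.Additive.CccOneZetaLinesCoherent

end
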